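import Literature.Barriers.MatrixMultiplication.LinearRankMethodBarrier
import Literature.Computability.AlgebraicComplexity.ApolarityBound
import Literature.Computability.AlgebraicComplexity.RankMethodBarriersProofs
import HarnessLib

/-!
# Proof of the cactus barrier for three-factor Segre formats (Buczyński 2026)

Topic `Literature/Barriers/MatrixMultiplication`; discharges the named fact
`Buczynski2026_cactusBarrier_segre` of `LinearRankMethodBarrier.lean` and — together with the
discharge `EGOW2018_thm44_holds` of the EGOW rank-method barrier
(`Literature/Computability/AlgebraicComplexity/RankMethodBarriersProofs.lean`) — the catalogue
entry `LinearRankMethodBarrier` (`LinearRankMethodBarrier_holds`).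

The proof instantiates the apolarity bound `MonomialChart.rank_le_mul_rank_hankel`
(`Literature/Computability/AlgebraicComplexity/ApolarityBound.lean`) on the AFFINE chart of the
Segre variety at `e_{i₀} ⊗ e_{j₀} ⊗ e_{l₀}`: variables `σ = (ι∖i₀ ⊔ κ∖j₀) ⊔ μ∖l₀`
(`|σ| = a+b+c−3 = dim X`), exponents `α(i,j,l) = e_i + e_j + e_l` (with `e_{i₀} = e_{j₀} = e_{l₀} = 0`),
whose points `χ(y)` are the rank-one tensors `w ⊗ u ⊗ v` with `w_{i₀} = u_{j₀} = v_{l₀} = 1`. All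
exponents have degree `≤ 3`, so by support splitting (`MonomialChart.rank_hankel_le` with
`e = e' = 1`) the Hankel matrix of any `t` has rank `≤ 2 · #{β : |β| ≤ 1} ≤ 2(|σ| + 1) = 2(a+b+c−2)`
— Buczyński's `g = 2(a+b+c−2)` [Buczynski2026, §1.3], i.e. the length `2 dim X + 2` of the
local apolar scheme of Bernardi–Ranestad — and the apolarity bound gives
`rk L(t) ≤ k · 2(a+b+c−2)`.
-/

noncomputable section

open scoped BigOperators

namespace Literature.Barriers.MatrixMultiplication

open Literature.Computability.AlgebraicComplexity
open Literature.Computability.AlgebraicComplexity.MonomialChart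

/-- `|{i : i ≠ i₀}| = |ι| − 1`. [folklore] -/
theorem card_subtype_ne {ι : Type*} [Fintype ι] [DecidableEq ι] (i₀ : ι) :
    Fintype.card {i // i ≠ i₀} = Fintype.card ι - 1 := by
  rw [Fintype.card_subtype_compl, Fintype.card_subtype_eq]

/-- **Buczyński 2026, Thm. 2 / Cor. 13 with §1.3, proved**: a linear rank method with `rk ≤ k`
on rank-one tensors of `ℂ^a ⊗ ℂ^b ⊗ ℂ^c` has `rk L(t) ≤ k · 2(a+b+c−2)` on every tensor.
[cite: Buczynski2026, Thm. 2, Cor. 13 and §1.3] -/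
theorem Buczynski2026_cactusBarrier_segre_holds : Buczynski2026_cactusBarrier_segre := by
  intro ι κ μ _ _ _ a b c ha hb hc hι hκ hμ p q L k hk t
  classical
  -- base points of the affine chart
  obtain ⟨i₀⟩ : Nonempty ι := Fintype.card_pos_iff.1 (by omega)
  obtain ⟨j₀⟩ : Nonempty κ := Fintype.card_pos_iff.1 (by omega)
  obtain ⟨l₀⟩ : Nonempty μ := Fintype.card_pos_iff.1 (by omega)
  -- variables and exponents of the chart
  let σ := ({i // i ≠ i₀} ⊕ {j // j ≠ j₀}) ⊕ {l // l ≠ l₀}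
  let eι : ι → σ →₀ ℕ := fun i =>
    if h : i = i₀ then 0 else Finsupp.single (Sum.inl (Sum.inl ⟨i, h⟩)) 1
  let eκ : κ → σ →₀ ℕ := fun j =>
    if h : j = j₀ then 0 else Finsupp.single (Sum.inl (Sum.inr ⟨j, h⟩)) 1
  let eμ : μ → σ →₀ ℕ := fun l =>
    if h : l = l₀ then 0 else Finsupp.single (Sum.inr ⟨l, h⟩) 1
  let α : ι × κ × μ → σ →₀ ℕ := fun x => eι x.1 + eκ x.2.1 + eμ x.2.2
  -- values of the exponents on the three groups of variables
  have hι1 : ∀ (i : ι) (y : {i // i ≠ i₀}),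
      eι i (Sum.inl (Sum.inl y)) = if i = y.1 then 1 else 0 := by
    intro i y
    simp only [eι]
    by_cases hi : i = i₀
    · rw [dif_pos hi, if_neg (fun h => y.2 (by rw [← h]; exact hi))]; rfl
    · rw [dif_neg hi, Finsupp.single_apply]
      by_cases hy : i = y.1
      · rw [if_pos hy, if_pos]; subst hy; rfl
      · rw [if_neg hy, if_neg]
        intro h
        exact hy (congrArg Subtype.val (Sum.inl_injective (Sum.inl_injective h)))
  have hι2 : ∀ (i : ι) (y : {j // j ≠ j₀}), eι i (Sum.inl (Sum.inr y)) = 0 := by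
    intro i y; simp only [eι]; split_ifs
    · rfl
    · exact Finsupp.single_eq_of_ne (by intro h'; cases h')
  have hι3 : ∀ (i : ι) (y : {l // l ≠ l₀}), eι i (Sum.inr y) = 0 := by
    intro i y; simp only [eι]; split_ifs
    · rfl
    · exact Finsupp.single_eq_of_ne (by intro h'; cases h')
  have hκ1 : ∀ (j : κ) (y : {i // i ≠ i₀}), eκ j (Sum.inl (Sum.inl y)) = 0 := by
    intro j y; simp only [eκ]; split_ifs
    · rfl
    · exact Finsupp.single_eq_of_ne (by intro h'; cases h')
  have hκ2 : ∀ (j : κ) (y : {j // j ≠ j₀}),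
      eκ j (Sum.inl (Sum.inr y)) = if j = y.1 then 1 else 0 := by
    intro j y
    simp only [eκ]
    by_cases hj : j = j₀
    · rw [dif_pos hj, if_neg (fun h => y.2 (by rw [← h]; exact hj))]; rfl
    · rw [dif_neg hj, Finsupp.single_apply]
      by_cases hy : j = y.1
      · rw [if_pos hy, if_pos]; subst hy; rfl
      · rw [if_neg hy, if_neg]
        intro h
        exact hy (congrArg Subtype.val (Sum.inr_injective (Sum.inl_injective h)))
  have hκ3 : ∀ (j : κ) (y : {l // l ≠ l₀}), eκ j (Sum.inr y) = 0 := by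
    intro j y; simp only [eκ]; split_ifs
    · rfl
    · exact Finsupp.single_eq_of_ne (by intro h'; cases h')
  have hμ1 : ∀ (l : μ) (y : {i // i ≠ i₀}), eμ l (Sum.inl (Sum.inl y)) = 0 := by
    intro l y; simp only [eμ]; split_ifs
    · rfl
    · exact Finsupp.single_eq_of_ne (by intro h'; cases h')
  have hμ2 : ∀ (l : μ) (y : {j // j ≠ j₀}), eμ l (Sum.inl (Sum.inr y)) = 0 := by
    intro l y; simp only [eμ]; split_ifs
    · rfl
    · exact Finsupp.single_eq_of_ne (by intro h'; cases h')
  have hμ3 : ∀ (l : μ) (y : {l // l ≠ l₀}),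
      eμ l (Sum.inr y) = if l = y.1 then 1 else 0 := by
    intro l y
    simp only [eμ]
    by_cases hl : l = l₀
    · rw [dif_pos hl, if_neg (fun h => y.2 (by rw [← h]; exact hl))]; rfl
    · rw [dif_neg hl, Finsupp.single_apply]
      by_cases hy : l = y.1
      · rw [if_pos hy, if_pos]; subst hy; rfl
      · rw [if_neg hy, if_neg]
        intro h
        exact hy (congrArg Subtype.val (Sum.inr_injective h))
  have hα1 : ∀ (x : ι × κ × μ) (y : {i // i ≠ i₀}),
      α x (Sum.inl (Sum.inl y)) = if x.1 = y.1 then 1 else 0 := by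
    intro x y; simp only [α, Finsupp.add_apply, hι1, hκ1, hμ1, add_zero]
  have hα2 : ∀ (x : ι × κ × μ) (y : {j // j ≠ j₀}),
      α x (Sum.inl (Sum.inr y)) = if x.2.1 = y.1 then 1 else 0 := by
    intro x y; simp only [α, Finsupp.add_apply, hι2, hκ2, hμ2, add_zero, zero_add]
  have hα3 : ∀ (x : ι × κ × μ) (y : {l // l ≠ l₀}),
      α x (Sum.inr y) = if x.2.2 = y.1 then 1 else 0 := by
    intro x y; simp only [α, Finsupp.add_apply, hι3, hκ3, hμ3, zero_add]
  -- the exponents are distinct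
  have key : ∀ {τ : Type} (z₀ : τ) (f : ι × κ × μ → τ) (ev : ∀ (x : ι × κ × μ) (y : {z // z ≠ z₀}), ℕ),
      (∀ x y, ev x y = if f x = y.1 then 1 else 0) →
      ∀ x x', (∀ y, ev x y = ev x' y) → f x = f x' := by
    intro τ z₀ f ev hev x x' h
    by_cases hx : f x = z₀
    · by_cases hx' : f x' = z₀
      · rw [hx, hx']
      · have h1 := h ⟨f x', hx'⟩
        rw [hev, hev, if_pos rfl] at h1
        by_contra hne
        rw [if_neg hne] at h1
        exact zero_ne_one h1
    · have h1 := h ⟨f x, hx⟩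
      rw [hev, hev, if_pos rfl] at h1
      by_contra hne
      rw [if_neg (Ne.symm hne)] at h1
      exact one_ne_zero h1
  have hα : Function.Injective α := by
    intro x x' h
    have e1 : x.1 = x'.1 :=
      key i₀ (fun x => x.1) (fun x y => α x (Sum.inl (Sum.inl y))) hα1 x x' (fun y => by rw [h])
    have e2 : x.2.1 = x'.2.1 :=
      key j₀ (fun x => x.2.1) (fun x y => α x (Sum.inl (Sum.inr y))) hα2 x x' (fun y => by rw [h])
    have e3 : x.2.2 = x'.2.2 :=
      key l₀ (fun x => x.2.2) (fun x y => α x (Sum.inr y)) hα3 x x' (fun y => by rw [h])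
    exact Prod.ext e1 (Prod.ext e2 e3)
  -- the exponents have degree ≤ 3
  have hdeg : ∀ x, (α x).degree ≤ 1 + 1 + 1 := by
    intro x
    have d1 : (eι x.1).degree ≤ 1 := by
      simp only [eι]; split_ifs <;> simp
    have d2 : (eκ x.2.1).degree ≤ 1 := by
      simp only [eκ]; split_ifs <;> simp
    have d3 : (eμ x.2.2).degree ≤ 1 := by
      simp only [eμ]; split_ifs <;> simp
    simp only [α, map_add]
    omega
  -- the points of the chart are rank-one tensors
  let wf : (σ → ℂ) → ι → ℂ := fun y i => if h : i = i₀ then 1 else y (Sum.inl (Sum.inl ⟨i, h⟩))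
  let uf : (σ → ℂ) → κ → ℂ := fun y j => if h : j = j₀ then 1 else y (Sum.inl (Sum.inr ⟨j, h⟩))
  let vf : (σ → ℂ) → μ → ℂ := fun y l => if h : l = l₀ then 1 else y (Sum.inr ⟨l, h⟩)
  have hw : ∀ (y : σ → ℂ) (i : ι), ∏ s, y s ^ (eι i s) = wf y i := by
    intro y i; simp only [eι, wf]
    split_ifs
    · simp
    · exact prod_pow_single y _
  have hu : ∀ (y : σ → ℂ) (j : κ), ∏ s, y s ^ (eκ j s) = uf y j := by
    intro y j; simp only [eκ, uf]
    split_ifs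
    · simp
    · exact prod_pow_single y _
  have hv : ∀ (y : σ → ℂ) (l : μ), ∏ s, y s ^ (eμ l s) = vf y l := by
    intro y l; simp only [eμ, vf]
    split_ifs
    · simp
    · exact prod_pow_single y _
  -- uncurrying `ι × κ × μ → ℂ` to `ι → κ → μ → ℂ`
  let U : (ι × κ × μ → ℂ) →ₗ[ℂ] (ι → κ → μ → ℂ) :=
    { toFun := fun f i j l => f (i, j, l)
      map_add' := fun _ _ => rfl
      map_smul' := fun _ _ => rfl }
  have hpt : ∀ y : σ → ℂ, U (point α y) = triad (wf y) (uf y) (vf y) := by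
    intro y
    funext i j l
    change (∏ s, y s ^ ((eι i + eκ j + eμ l) s)) = _
    rw [triad_apply, prod_pow_add, prod_pow_add, hw, hu, hv]
  -- apply the apolarity bound to `L ∘ U`
  set L' : (ι × κ × μ → ℂ) →ₗ[ℂ] Matrix (Fin p) (Fin q) ℂ := L ∘ₗ U with hL'
  have hk' : ∀ y : σ → ℂ, (L' (point α y)).rank ≤ k := by
    intro y
    rw [hL', LinearMap.comp_apply, hpt]
    exact hk _ _ _
  let t' : ι × κ × μ → ℂ := fun x => t x.1 x.2.1 x.2.2
  have ht : L t = L' t' := by rw [hL', LinearMap.comp_apply]; rfl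
  have hmain := rank_le_mul_rank_hankel hα L' k hk' t'
  -- count: `rk H_t ≤ 2 (|σ| + 1) = 2 (a + b + c - 2)`
  have hσ : Fintype.card σ + 1 = a + b + c - 2 := by
    simp only [σ, Fintype.card_sum, card_subtype_ne, hι, hκ, hμ]
    omega
  have hH : (hankel α t').rank ≤ 2 * (a + b + c - 2) := by
    refine (rank_hankel_le α t' 1 1 hdeg).trans ?_
    have h1 := card_filter_degree_le_one_le α
    omega
  calc (L t).rank = (L' t').rank := by rw [ht]
    _ ≤ k * (hankel α t').rank := hmain
    _ ≤ k * (2 * (a + b + c - 2)) := Nat.mul_le_mul_left k hH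

/-- **The catalogue entry `LinearRankMethodBarrier`, proved** (both conjuncts: Buczyński's cactus
barrier for three-factor Segre formats over `ℂ`, and EGOW 2018 Thm. 4.4).
[cite: Buczynski2026, Thm. 2] -/
theorem LinearRankMethodBarrier_holds : LinearRankMethodBarrier :=
  ⟨Buczynski2026_cactusBarrier_segre_holds,
    Literature.Computability.AlgebraicComplexity.EGOW2018_thm44_holds⟩

end Literature.Barriers.MatrixMultiplication

end
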